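import Summits.HodgeConjecture.HodgeConjecture.Theorems.H413CohFormsHodgeTypesDisjoint
import Summits.HodgeConjecture.HodgeConjecture.Theorems.P4StubT1ArchFactor
import HarnessLib

/-!
# FLOOR-0 P3 «U3-mult», line `F0_U3CohMultOne` — STUB S2 CLOSED: the two Hodge types of cotangent forms are disjoint and Hecke-stable

Cell hodgecm-mathlib (D-0151), FLOOR 0, crux item H413 = stmt-HodgeConjecture-24833; line `Cruxes/H413/Lines/F0_U3CohMultOne.lean` v1.1
(sha16 cf02d7697f46cc99; F0P3-plan (g0)), registered stub `stub_S2_hodgeTypesDisjointStable : StubS2HodgeTypesDisjointStable` (§2 ∕ §4 there).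
PROOF lane; author A-p09 (g18) (JOIN BRIEF seat «A-p09: S2»).  This file proves the REGISTERED declaration's TYPE, restated BINDER FOR BINDER
(token-identically to the body of `…Cruxes.H413.F0U3CohMultOne.StubS2HodgeTypesDisjointStable`; the Lines module itself is not imported
because crux workfiles are not built on the farm — same pattern as ★ `P4StubT1ArchFactor.stubT1ArchFactor_holds`), so that the line's next edition
closes the hole BY NAME: `theorem stub_S2_hodgeTypesDisjointStable : StubS2HodgeTypesDisjointStable := F0P3StubS2HodgeTypes.stubS2_holds`
(kernel certificate of the token identity: HOME `A-provers/A-p09/g18/CERT-S2-token-identity.A-p09g18.lean`, rc 0).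

Content: for every `(F, V)`, at the archimedean factor of record `𝔞₀ = archFactorOf F V`:  `Disjoint (holCotForms 𝔞₀) ((holCotForms 𝔞₀).map conjFun)`,
and both `holCotForms 𝔞₀` and `(holCotForms 𝔞₀).map conjFun` are stable under the finite-adèlic right translation `rightRep F V g`.  It is the
specialisation at `𝔞₀` (honest by ★ `P4StubT1ArchFactor.archFactorOf_isHonest`) of ★ `CohFormsCarriers.ArchFactor.IsHonest.hodgeTypes_disjoint_stable`
(`Theorems/H413CohFormsHodgeTypesDisjoint.lean`, p790158: disjointness from the cotangent `K_∞`-weight `τ₁ = 𝔭₋` on the central circle of `Stab(x₀)` —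
`i` versus `−i` — for ANY `𝔞`, no holomorphy used; stability from ★ `IsHonest.rightRep_mem_holCotForms` + ★ `conjFun_rightRep`, A-p13 (g21)).

HC_CM is proved only modulo the 7 printed citations until rung 0 closes; this closes ONE of the five stubs of ONE floor-0 line (S1, S3, S4, S5 open).

## References
* [BorelWallach2000] A. Borel, N. Wallach, 2nd ed., AMS 2000 — VI 4.8 (`τ₁ = 𝔭₋`), VII 2.10 (Hodge bigrading of cochains ∕ forms), VII 3.2.
* [Borel1997] A. Borel, *Automorphic forms on `SL₂(ℝ)`*, CUP 1997 — §5.14 (forms of a given `K`-type as sections).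
* [BorelJacquet1979] A. Borel, H. Jacquet, PSPM 33.1 — §4.2 (right translation, smoothness).
-/

set_option autoImplicit false
set_option linter.dupNamespace false

noncomputable section

namespace Summit.HodgeConjecture.HodgeConjecture.Cruxes.H413.F0P3StubS2HodgeTypes

open Summit.HodgeConjecture.HodgeConjecture.Cruxes.H413.CohFormsCarriers

/-- **STUB S2 of line `F0_U3CohMultOne`, proved** — the body of `StubS2HodgeTypesDisjointStable` binder for binder: at the factor of record
`archFactorOf F V` the holomorphic cotangent forms and their conjugates are DISJOINT (`K_∞`-weight `i` vs `−i` on the central circle of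
`Stab(x₀)`, ★ `disjoint_holCotForms_map_conjFun`) and each is STABLE under `rightRep F V g` (★ `IsHonest.rightRep_mem_holCotForms`,
★ `conjFun_rightRep`, honesty ★ `archFactorOf_isHonest`). [cite: BorelWallach2000, VII 2.10] [cite: BorelWallach2000, VI 4.8] [cite: Borel1997, §5.14]
[cite: BorelJacquet1979, §4.2] -/
theorem stubS2_holds :
    ∀ (F : HodgeCM.CMField) {ι₁ : F →+* ℂ} (V : HodgeCM.HermSpace3 F ι₁),
    Disjoint (holCotForms (archFactorOf F V)) ((holCotForms (archFactorOf F V)).map (conjFun F V)) ∧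
      (∀ (g : ↥(HodgeCM.HermSpace3.adelicFin V)) (f : (adelicDatum F V).Adelic → (Fin 2 → ℂ)),
          f ∈ holCotForms (archFactorOf F V) → rightRep F V g f ∈ holCotForms (archFactorOf F V)) ∧
      (∀ (g : ↥(HodgeCM.HermSpace3.adelicFin V)) (f : (adelicDatum F V).Adelic → (Fin 2 → ℂ)),
          f ∈ (holCotForms (archFactorOf F V)).map (conjFun F V) →
            rightRep F V g f ∈ (holCotForms (archFactorOf F V)).map (conjFun F V)) :=
  fun F _ V => (P4StubT1ArchFactor.archFactorOf_isHonest F V).hodgeTypes_disjoint_stable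

end Summit.HodgeConjecture.HodgeConjecture.Cruxes.H413.F0P3StubS2HodgeTypes

end
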